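import Literature.InformationTheory.QuantumCodes.DrawnCheckMatrixCountingBound
import Literature.InformationTheory.QuantumCodes.CSSPhenomenologicalThreshold
import HarnessLib

/-!
# The space-time lift of a check matrix drawn on `ℤ^d`: the `T`-round memory experiment (noisy syndrome measurement) drawn on
# `ℤ^{d+1}`, its height gap, and the Dennis–Kitaev–Landahl–Preskill counting bound with measurement errors (`q = p`)

Topic `Literature/InformationTheory/QuantumCodes` (venture QEC, LADDER-QEC rung Q5, PARTITION row 09 "phenomenological";
qec-type-09 gen 7, cell item «09.RSCPH»). All PROVED, kernel axioms, no named fact. Given a drawing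
`Δ : CheckDrawing H d B Tt` of a check matrix `H : X × Q → 𝔽₂` (`DrawnCheckMatrixCrossingPaths.lean`) and lit-2's generic
space-time code of `T` noisy rounds (`CSSPhenomenologicalThreshold.lean`: fault locations `HistoryLoc Q X T` = qubit faults
`(q, t)` and measurement faults `(x, t)`, space-time checks `(x, τ)`, `τ ≤ T`, boundary matrix `CSSPhenom.stMatrix H T`),
following Dennis–Kitaev–Landahl–Preskill §4.2 ("a three-dimensional simple cubic lattice, with the third dimension
representing an integer-valued time … Errors on horizontal links … on vertical links") we draw the space-time code on
`ℤ^{d+1}` (time as the NEW FIRST coordinate, `up τ P = (τ, P)`):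

* `CheckDrawing.spaceTime Δ T` — the space-time check `(x, τ)` at `(τ, site x)`; the qubit fault `(q, t)` is the bond of
  `q` at height `t`; the measurement fault `(x, t)` is the vertical bond `{(t, site x), (t+1, site x)}`; the virtual sites
  are the virtual sites of `Δ` at every height `t < T`; `bot (q, t) = bot q`, `bot (x, t) = 0`. INCIDENCE = GEOMETRY for
  the space-time matrix (`stMatrix H T (x,τ) ℓ = [(τ, site x) ∈ bond ℓ]`) is proved from that of `Δ`, so the hand-shaking
  lemma, the crossing paths and the counting bound of the generic files apply verbatim;
* `spaceTime_heightGap` — a height gap of `Δ` is a height gap of the lift (compose with the spatial projection);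
* `sum_mul_bot_spaceTime` — the bottom crossing number of a history is that of its projection `Π`;
* ★ `spaceTime_sum_oddResidual_le_twoRate`, `spaceTime_sum_oddResidual_le` — for a minimum-weight SPACE-TIME decoder, qubit
  rate `p` and measurement rate `q` with `p, q ≤ ρ ≤ 1/2` (resp. `q = p`), a walk count `cₙ(ℤ^{d+1}) ≤ C νⁿ` and a height gap
  `n₀`: `Σ_{E : Π(residual) has an odd bottom crossing} w(E) ≤ |B|·T·C·r^{n₀}/(1-r)`, `r = 2ν√(ρ(1-ρ))` (DKLP eq. (fail_iso),
  relative form: `|B|·T` bottom space-time sites to start from; the box `p, q ≤ ρ` of eq. (threshold_iso_num)).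

## References

* [DennisEtAl2002] E. Dennis, A. Kitaev, A. Landahl, J. Preskill, *Topological quantum memory*, J. Math. Phys. 43 (2002)
  4452–4505, arXiv:quant-ph/0110143, §4.2 (the space-time lattice: horizontal links = qubit errors, vertical links =
  measurement errors), §4.3 (syndrome = boundary), §5.2–5.3 (eqs. (e_ineq), (saw_L), (saw_3), (fail_iso); relative polygons).
* [DumerKovalevPryadko2015] I. Dumer, A. A. Kovalev, L. P. Pryadko, PRL 115 (2015) 050502, p. 5 (repetition code in time).
-/

namespace Literature.InformationTheory.QuantumCodes

namespace CheckDrawing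

open Finset Matrix CSSPhenom
open Literature.Probability.LatticeModels (Site zdGraph)
open Literature.Probability.RandomPlanarGeometry
open Literature.Probability.RandomPlanarGeometry.SAW.Zd (zdGraph_adj_iff_sub)

variable {X Q B Tt : Type*} {d : ℕ} {H : Matrix X Q (ZMod 2)}

/-! ### Sites of `ℤ^{d+1}`: time first -/

/-- The space-time site `(τ, P) ∈ ℤ^{d+1}` above the site `P ∈ ℤ^d` at time `τ`. [cite: DennisEtAl2002, §4.2 (vertices of the space-time lattice)] -/
def up (τ : ℤ) (P : Site d) : Site (d + 1) := Matrix.vecCons τ P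

/-- Space-time sites are determined by their time and place. [cite: DennisEtAl2002, §4.2 (vertices of the space-time lattice)] -/
theorem up_inj {τ τ' : ℤ} {P P' : Site d} : up τ P = up τ' P' ↔ τ = τ' ∧ P = P' := Matrix.vecCons_inj

/-- Coordinatewise subtraction. [folklore] -/
private theorem up_sub_up (τ τ' : ℤ) (P P' : Site d) : up τ P - up τ' P' = up (τ - τ') (P - P') :=
  Matrix.cons_sub_cons _ _ _ _

/-- The time unit vector. [folklore] -/
private theorem single_zero_eq_up : (Pi.single (0 : Fin (d + 1)) (1 : ℤ) : Site (d + 1)) = up 1 0 := by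
  funext j
  refine Fin.cases ?_ (fun i => ?_) j
  · rw [up, Matrix.cons_val_zero, Pi.single_apply, if_pos rfl]
  · rw [up, Matrix.cons_val_succ, Pi.single_apply, if_neg (Fin.succ_ne_zero i), Pi.zero_apply]

/-- The spatial unit vectors. [folklore] -/
private theorem single_succ_eq_up (i : Fin d) : (Pi.single i.succ (1 : ℤ) : Site (d + 1)) = up 0 (Pi.single i 1) := by
  funext j
  refine Fin.cases ?_ (fun k => ?_) j
  · rw [up, Matrix.cons_val_zero, Pi.single_apply, if_neg (Fin.succ_ne_zero i).symm]
  · rw [up, Matrix.cons_val_succ, Pi.single_apply, Pi.single_apply]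
    simp only [Fin.succ_inj]

/-- **Horizontal links**: adjacent sites stay adjacent at every height. [cite: DennisEtAl2002, §4.2 (horizontal links of a time slice)] -/
theorem adj_up_up {P P' : Site d} (h : (zdGraph d).Adj P P') (τ : ℤ) : (zdGraph (d + 1)).Adj (up τ P) (up τ P') := by
  rw [zdGraph_adj_iff_sub] at h ⊢
  obtain ⟨i, hi | hi⟩ := h
  · exact ⟨i.succ, Or.inl (by rw [up_sub_up, sub_self, hi, single_succ_eq_up])⟩
  · exact ⟨i.succ, Or.inr (by rw [up_sub_up, sub_self, hi, single_succ_eq_up])⟩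

/-- **Vertical links**: `(τ, P)` and `(τ+1, P)` are adjacent. [cite: DennisEtAl2002, §4.2 (vertical links = time steps)] -/
theorem adj_up_succ (τ : ℤ) (P : Site d) : (zdGraph (d + 1)).Adj (up τ P) (up (τ + 1) P) := by
  rw [zdGraph_adj_iff_sub]
  exact ⟨0, Or.inl (by rw [up_sub_up, sub_self, add_sub_cancel_left, single_zero_eq_up])⟩

/-! ### The space-time boundary matrix, unfolded -/

/-- The space-time check `(x, τ)` sees the qubit fault `(q, t)` iff `τ = t` and `x` sees `q`. [cite: DumerKovalevPryadko2015, p. 5] -/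
private theorem stMatrix_inl [DecidableEq X] (T : ℕ) (x : X × Fin (T + 1)) (qt : Q × Fin T) :
    stMatrix H T x (Sum.inl qt) = if x.2 = qt.2.castSucc then H x.1 qt.1 else 0 := rfl

/-- The space-time check `(x, τ)` sees the measurement fault `(x', t)` iff `x = x'` and `τ ∈ {t, t+1}`. [cite: DumerKovalevPryadko2015, p. 5] -/
private theorem stMatrix_inr [DecidableEq X] (T : ℕ) (x : X × Fin (T + 1)) (ct : X × Fin T) :
    stMatrix H T x (Sum.inr ct) = if x.1 = ct.1 ∧ (x.2 = ct.2.castSucc ∨ x.2 = ct.2.succ) then 1 else 0 := rfl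

/-! ### The lift -/

/-- ★ **The space-time lift of a drawing** (DKLP §4.2): checks `(x, τ)` at `(τ, site x)`; qubit faults as the bonds of `Δ`
at their height; measurement faults as vertical bonds; virtual sites at every height; `bot` from `Δ` on qubit faults and
`0` on measurement faults. All axioms of a drawing — in particular INCIDENCE = GEOMETRY for `CSSPhenom.stMatrix H T` — are
inherited. [cite: DennisEtAl2002, §4.2 (the space-time simple cubic lattice; horizontal and vertical links) and §4.3 (syndrome = boundary)] -/
def spaceTime [DecidableEq X] (Δ : CheckDrawing H d B Tt) (T : ℕ) :
    CheckDrawing (stMatrix H T) (d + 1) (B × Fin T) (Tt × Fin T) where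
  site x := up ((x.2 : ℕ) : ℤ) (Δ.site x.1)
  bond := Sum.elim (fun qt : Q × Fin T => (Δ.bond qt.1).map (up ((qt.2 : ℕ) : ℤ)))
    (fun ct : X × Fin T => s(up ((ct.2 : ℕ) : ℤ) (Δ.site ct.1), up (((ct.2 : ℕ) : ℤ) + 1) (Δ.site ct.1)))
  vb bt := up ((bt.2 : ℕ) : ℤ) (Δ.vb bt.1)
  vt tt := up ((tt.2 : ℕ) : ℤ) (Δ.vt tt.1)
  bot := Sum.elim (fun qt : Q × Fin T => Δ.bot qt.1) (fun _ => 0)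
  site_injective := by
    rintro ⟨x, τ⟩ ⟨x', τ'⟩ h
    obtain ⟨h1, h2⟩ := up_inj.1 h
    simp only at h1 h2
    have hτ : τ = τ' := Fin.ext (by exact_mod_cast h1)
    exact Prod.ext (Δ.site_injective h2) hτ
  bond_injective := by
    rintro (⟨q, t⟩ | ⟨c, t⟩) (⟨q', t'⟩ | ⟨c', t'⟩) h
    · obtain ⟨A, A', hA⟩ := Δ.exists_bond_eq q
      obtain ⟨D, D', hD⟩ := Δ.exists_bond_eq q'
      simp only [Sum.elim_inl, hA, hD, Sym2.map_mk, Sym2.eq_iff, up_inj] at h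
      have ht : t = t' := Fin.ext (by rcases h with ⟨⟨h1, -⟩, -⟩ | ⟨⟨h1, -⟩, -⟩ <;> exact_mod_cast h1)
      subst ht
      have hqq : Δ.bond q = Δ.bond q' := by
        rw [hA, hD, Sym2.eq_iff]
        rcases h with ⟨⟨-, h1⟩, -, h2⟩ | ⟨⟨-, h1⟩, -, h2⟩
        · exact Or.inl ⟨h1, h2⟩
        · exact Or.inr ⟨h1, h2⟩
      rw [Δ.bond_injective hqq]
    · exfalso
      obtain ⟨A, A', hA⟩ := Δ.exists_bond_eq q
      simp only [Sum.elim_inl, Sum.elim_inr, hA, Sym2.map_mk, Sym2.eq_iff, up_inj] at h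
      rcases h with ⟨⟨h1, -⟩, h2, -⟩ | ⟨⟨h1, -⟩, h2, -⟩ <;> omega
    · exfalso
      obtain ⟨D, D', hD⟩ := Δ.exists_bond_eq q'
      simp only [Sum.elim_inl, Sum.elim_inr, hD, Sym2.map_mk, Sym2.eq_iff, up_inj] at h
      rcases h with ⟨⟨h1, -⟩, h2, -⟩ | ⟨⟨h1, -⟩, h2, -⟩ <;> omega
    · simp only [Sum.elim_inr, Sym2.eq_iff, up_inj] at h
      rcases h with ⟨⟨h1, h2⟩, -⟩ | ⟨⟨h1, -⟩, h2, -⟩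
      · have ht : t = t' := Fin.ext (by exact_mod_cast h1)
        rw [Δ.site_injective h2, ht]
      · omega
  adj_of_bond_eq := by
    rintro (⟨q, t⟩ | ⟨c, t⟩) P P' h
    · obtain ⟨A, A', hA⟩ := Δ.exists_bond_eq q
      have hadj := adj_up_up (Δ.adj_of_bond_eq q A A' hA) ((t : ℕ) : ℤ)
      simp only [Sum.elim_inl, hA, Sym2.map_mk, Sym2.eq_iff] at h
      rcases h with ⟨rfl, rfl⟩ | ⟨rfl, rfl⟩
      · exact hadj
      · exact hadj.symm
    · have hadj := adj_up_succ ((t : ℕ) : ℤ) (Δ.site c)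
      simp only [Sum.elim_inr, Sym2.eq_iff] at h
      rcases h with ⟨rfl, rfl⟩ | ⟨rfl, rfl⟩
      · exact hadj
      · exact hadj.symm
  apply_eq_ite := by
    classical
    rintro ⟨x, τ⟩ (⟨q, t⟩ | ⟨c, t⟩)
    · rw [stMatrix_inl]
      simp only [Sum.elim_inl, Sym2.mem_map, up_inj]
      by_cases hτ : τ = t.castSucc
      · rw [if_pos hτ, Δ.apply_eq_ite]
        have hv : ((τ : ℕ) : ℤ) = ((t : ℕ) : ℤ) := by rw [hτ, Fin.val_castSucc]
        by_cases hm : Δ.site x ∈ Δ.bond q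
        · rw [if_pos hm, if_pos ⟨Δ.site x, hm, hv.symm, rfl⟩]
        · rw [if_neg hm, if_neg]
          rintro ⟨a, ha, -, rfl⟩
          exact hm ha
      · rw [if_neg hτ, if_neg]
        rintro ⟨a, -, h1, -⟩
        apply hτ
        exact Fin.ext (by rw [Fin.val_castSucc]; exact_mod_cast h1.symm)
    · rw [stMatrix_inr]
      simp only [Sum.elim_inr, Sym2.mem_iff, up_inj, Δ.site_injective.eq_iff, Fin.ext_iff, Fin.val_castSucc,
        Fin.val_succ]
      by_cases h1 : x = c
      · subst h1
        by_cases h2 : ((τ : ℕ) = (t : ℕ) ∨ (τ : ℕ) = (t : ℕ) + 1)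
        · rw [if_pos ⟨rfl, h2⟩, if_pos]
          rcases h2 with h2 | h2
          · exact Or.inl ⟨by exact_mod_cast h2, rfl⟩
          · exact Or.inr ⟨by exact_mod_cast h2, rfl⟩
        · rw [if_neg (fun h => h2 h.2), if_neg]
          rintro (⟨h3, -⟩ | ⟨h3, -⟩)
          · exact h2 (Or.inl (by exact_mod_cast h3))
          · exact h2 (Or.inr (by exact_mod_cast h3))
      · rw [if_neg (fun h => h1 h.1), if_neg]
        rintro (⟨-, h3⟩ | ⟨-, h3⟩) <;> exact h1 h3
  site_ne_vb := by
    rintro ⟨x, τ⟩ ⟨b, t⟩ h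
    exact Δ.site_ne_vb x b (up_inj.1 h).2
  site_ne_vt := by
    rintro ⟨x, τ⟩ ⟨t', t⟩ h
    exact Δ.site_ne_vt x t' (up_inj.1 h).2
  vb_ne_vt := by
    rintro ⟨b, t⟩ ⟨t', s⟩ h
    exact Δ.vb_ne_vt b t' (up_inj.1 h).2
  ends_cases := by
    classical
    rintro (⟨q, t⟩ | ⟨c, t⟩) P hP
    · simp only [Sum.elim_inl, Sym2.mem_map] at hP
      obtain ⟨a, ha, rfl⟩ := hP
      rcases Δ.ends_cases q a ha with ⟨x, hx⟩ | ⟨b, hb⟩ | ⟨t', ht'⟩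
      · exact Or.inl ⟨(x, t.castSucc), by simp only [Fin.val_castSucc, hx]⟩
      · exact Or.inr (Or.inl ⟨(b, t), by simp only [hb]⟩)
      · exact Or.inr (Or.inr ⟨(t', t), by simp only [ht']⟩)
    · simp only [Sum.elim_inr, Sym2.mem_iff] at hP
      rcases hP with rfl | rfl
      · exact Or.inl ⟨(c, t.castSucc), by simp only [Fin.val_castSucc]⟩
      · exact Or.inl ⟨(c, t.succ), by simp only [Fin.val_succ, Nat.cast_add, Nat.cast_one]⟩
  bot_eq := by
    classical
    have hvb : ∀ (P : Site d) (τ : ℤ), (∃ bt : B × Fin T, up ((bt.2 : ℕ) : ℤ) (Δ.vb bt.1) = up τ P) →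
        ∃ b, Δ.vb b = P := fun P τ ⟨bt, h⟩ => ⟨bt.1, (up_inj.1 h).2⟩
    rintro (⟨q, t⟩ | ⟨c, t⟩) P P' h
    · obtain ⟨A, A', hA⟩ := Δ.exists_bond_eq q
      simp only [Sum.elim_inl, hA, Sym2.map_mk, Sym2.eq_iff] at h
      have key : ∀ A₀ : Site d, (if ∃ bt : B × Fin T, up ((bt.2 : ℕ) : ℤ) (Δ.vb bt.1) = up ((t : ℕ) : ℤ) A₀ then
          (1 : ZMod 2) else 0) = if ∃ b, Δ.vb b = A₀ then 1 else 0 := by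
        intro A₀
        by_cases hb : ∃ b, Δ.vb b = A₀
        · obtain ⟨b, rfl⟩ := hb
          rw [if_pos ⟨(b, t), rfl⟩, if_pos ⟨b, rfl⟩]
        · rw [if_neg hb, if_neg (fun h' => hb (hvb A₀ _ h'))]
      simp only [Sum.elim_inl]
      rcases h with ⟨rfl, rfl⟩ | ⟨rfl, rfl⟩
      · rw [key, key, Δ.bot_eq q A A' hA]
      · rw [key, key, Δ.bot_eq q A A' hA, add_comm]
    · simp only [Sum.elim_inr, Sym2.eq_iff] at h
      have key : ∀ τ : ℤ, (if ∃ bt : B × Fin T, up ((bt.2 : ℕ) : ℤ) (Δ.vb bt.1) = up τ (Δ.site c) then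
          (1 : ZMod 2) else 0) = 0 := by
        intro τ
        rw [if_neg]
        intro h'
        obtain ⟨b, hb⟩ := hvb _ τ h'
        exact Δ.site_ne_vb c b hb.symm
      simp only [Sum.elim_inr]
      rcases h with ⟨rfl, rfl⟩ | ⟨rfl, rfl⟩ <;> rw [key, key, add_zero]

/-! ### What the lift inherits -/

/-- The spatial projection `(τ, P) ↦ P` of the space-time lattice, as an additive map (non-Prop plumbing). [folklore] -/
def tailHom (d : ℕ) : Site (d + 1) →+ Site d where
  toFun := Matrix.vecTail
  map_zero' := Matrix.tail_zero
  map_add' := Matrix.tail_add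

/-- The spatial projection forgets the time coordinate: `tail (τ, P) = P`. [cite: DennisEtAl2002, §4.2 (the space-time lattice projects onto the code lattice)] -/
@[simp] theorem tailHom_up (τ : ℤ) (P : Site d) : tailHom d (up τ P) = P := Matrix.tail_cons τ P

/-- **A height gap of the drawing is a height gap of its space-time lift** (compose the height with the spatial
projection: vertical links do not change it). [cite: DennisEtAl2002, §5.2 (H ≥ L on the space-time lattice)] -/
theorem spaceTime_heightGap [DecidableEq X] (Δ : CheckDrawing H d B Tt) (T : ℕ) {n₀ : ℕ} (h : Δ.HeightGap n₀) :
    (Δ.spaceTime T).HeightGap n₀ := by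
  obtain ⟨φ, c, hφ, hb, ht⟩ := h
  refine ⟨φ.comp (tailHom d), c, fun i => ?_, fun bt => ?_, fun tt => ?_⟩
  · refine Fin.cases ?_ (fun k => ?_) i
    · rw [single_zero_eq_up, AddMonoidHom.comp_apply, tailHom_up, map_zero, abs_zero]
      exact zero_le_one
    · rw [single_succ_eq_up, AddMonoidHom.comp_apply, tailHom_up]
      exact hφ k
  · show φ (tailHom d (up _ (Δ.vb bt.1))) = c
    rw [tailHom_up, hb]
  · show φ (tailHom d (up _ (Δ.vt tt.1))) = c + n₀
    rw [tailHom_up, ht]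

/-- **The bottom crossing number of a history is that of its projection**: `Σ_ℓ C(ℓ)·bot'(ℓ) = Σ_q Π(C)(q)·bot(q)`.
[cite: DennisEtAl2002, §6.1 (the projection Π) with §4.3] -/
theorem sum_mul_bot_spaceTime [Fintype X] [DecidableEq X] [Fintype Q] (Δ : CheckDrawing H d B Tt) (T : ℕ)
    (C : History X Q T) : ∑ ℓ, C ℓ * (Δ.spaceTime T).bot ℓ = ∑ q, proj C q * Δ.bot q := by
  simp only [spaceTime, Fintype.sum_sum_type, Sum.elim_inl, Sum.elim_inr, mul_zero, Finset.sum_const_zero, add_zero,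
    Fintype.sum_prod_type, proj_apply, Finset.sum_mul]

/-- The two phenomenological rates are non-negative when `p, q` are. [cite: DennisEtAl2002, §4.2 (rates p on horizontal, q on vertical links)] -/
theorem phenomRate_nonneg' {p q : ℝ} (hp : 0 ≤ p) (hq : 0 ≤ q) {T : ℕ} (ℓ : HistoryLoc Q X T) : 0 ≤ phenomRate p q ℓ := by
  rcases ℓ with ℓ | ℓ <;> simp [phenomRate, hp, hq]

/-- The two phenomenological rates are `≤ ρ` when `p, q ≤ ρ`. [cite: DennisEtAl2002, §4.2 (rates p, q)] -/
theorem phenomRate_le' {p q ρ : ℝ} (hp : p ≤ ρ) (hq : q ≤ ρ) {T : ℕ} (ℓ : HistoryLoc Q X T) : phenomRate p q ℓ ≤ ρ := by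
  rcases ℓ with ℓ | ℓ <;> simp [phenomRate, hp, hq]

open Classical in
/-- ★ **DKLP's counting bound with noisy syndrome measurement, generic, TWO RATES** (relative form of eq. (fail_iso)): for a
drawing `Δ` with `|B|` bottom virtual sites and height gap `n₀`, a minimum-weight space-time decoder `D` of the `T`-round
memory experiment (`∂ = stSyn H T`, cycles `stCycles H T`, Hamming weight), qubit rate `p` and measurement rate `q` with
`0 ≤ p, q ≤ ρ ≤ 1/2`, and a walk count `cₙ(ℤ^{d+1}) ≤ C νⁿ` with `r = 2ν√(ρ(1-ρ)) < 1`: the total probability of the histories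
whose residual projects to an odd bottom crossing is at most `|B|·T·C·r^{n₀}/(1-r)`.
[cite: DennisEtAl2002, §5.2 eqs. (saw_prob), (saw_L), §5.3 eqs. (saw_3), (fail_iso), (threshold_iso_num) (the box in p, q)] -/
theorem spaceTime_sum_oddResidual_le_twoRate [Fintype X] [DecidableEq X] [Fintype Q] [DecidableEq Q] [Fintype B]
    (Δ : CheckDrawing H d B Tt) (T : ℕ) {n₀ : ℕ} (hgap : Δ.HeightGap n₀) {C ν : ℝ} (hν : 0 < ν)
    (hC : ∀ n : ℕ, (SAW.Zd.count (d + 1) n : ℝ) ≤ C * ν ^ n) {D : STDecoder X Q T}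
    (hD : D.IsMinWeight (stSyn H T) (stCycles H T) hammingNorm)
    {p q ρ : ℝ} (hp0 : 0 ≤ p) (hq0 : 0 ≤ q) (hpρ : p ≤ ρ) (hqρ : q ≤ ρ) (hρ : ρ ≤ 1 / 2)
    (hr1 : 2 * ν * Real.sqrt (ρ * (1 - ρ)) < 1) :
    ∑ E ∈ univ.filter (fun E : History X Q T => ∑ q, proj (D (stSyn H T E) + E) q * Δ.bot q = 1),
        phenomenologicalWeight T p q (supp E) ≤
      (Fintype.card B : ℝ) * T * C * (2 * ν * Real.sqrt (ρ * (1 - ρ))) ^ n₀ / (1 - 2 * ν * Real.sqrt (ρ * (1 - ρ))) := by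
  classical
  have h := (Δ.spaceTime T).sum_indepWeight_oddResidual_le (Δ.spaceTime_heightGap T hgap) hν hC
    (D := D) hD (phenomRate_nonneg' hp0 hq0) (phenomRate_le' hpρ hqρ) hρ hr1
  rw [Fintype.card_prod, Fintype.card_fin, Nat.cast_mul] at h
  refine le_trans (le_of_eq (Finset.sum_congr (Finset.filter_congr fun E _ => ?_) fun _ _ => rfl)) h
  rw [sum_mul_bot_spaceTime]
  exact Iff.rfl

open Classical in
/-- ★ **DKLP's counting bound with noisy syndrome measurement, generic, `q = p`**: for a drawing `Δ` with `|B|` bottom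
virtual sites and height gap `n₀`, a minimum-weight space-time decoder `D`, equal rates `0 ≤ p ≤ 1/2`, and a walk count
`cₙ(ℤ^{d+1}) ≤ C νⁿ` with `r = 2ν√(p(1-p)) < 1`: the total probability of the histories whose residual projects to an odd
bottom crossing is at most `|B|·T·C·r^{n₀}/(1-r)`. [cite: DennisEtAl2002, §5.2 eqs. (saw_prob), (saw_L), §5.3 eqs. (saw_3), (fail_iso)] -/
theorem spaceTime_sum_oddResidual_le [Fintype X] [DecidableEq X] [Fintype Q] [DecidableEq Q] [Fintype B]
    (Δ : CheckDrawing H d B Tt) (T : ℕ) {n₀ : ℕ} (hgap : Δ.HeightGap n₀) {C ν : ℝ} (hν : 0 < ν)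
    (hC : ∀ n : ℕ, (SAW.Zd.count (d + 1) n : ℝ) ≤ C * ν ^ n) {D : STDecoder X Q T}
    (hD : D.IsMinWeight (stSyn H T) (stCycles H T) hammingNorm)
    {p : ℝ} (hp0 : 0 ≤ p) (hp : p ≤ 1 / 2) (hr1 : 2 * ν * Real.sqrt (p * (1 - p)) < 1) :
    ∑ E ∈ univ.filter (fun E : History X Q T => ∑ q, proj (D (stSyn H T E) + E) q * Δ.bot q = 1),
        phenomenologicalWeight T p p (supp E) ≤
      (Fintype.card B : ℝ) * T * C * (2 * ν * Real.sqrt (p * (1 - p))) ^ n₀ / (1 - 2 * ν * Real.sqrt (p * (1 - p))) :=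
  Δ.spaceTime_sum_oddResidual_le_twoRate T hgap hν hC hD hp0 hp0 le_rfl le_rfl hp hr1

end CheckDrawing

end Literature.InformationTheory.QuantumCodes
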